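import Literature.AlgebraicGeometry.Morphisms.HomSchemePieceOfLayers
import HarnessLib

/-!
# The Hom-scheme piece `M_Q` is QUASI-COMPACT over `S` (finite-type edition of ★ `exists_homSchemePiece_of_layers`)

Layer `Literature/AlgebraicGeometry/Morphisms`, namespace `Literature.AlgebraicGeometry.Morphisms`.  Theorems only: no definition, no named fact, no
instance, no notation, no `sorry`.  Universe `0`.

[MumfordFogartyKirwan1994] Ch. 0 §5 (c) ∕ [FGA] 221 §4.c: the piece `M_Q ⊂ V_Q ⊂ Hilb^Q((Y ×_S X)∕S)` of `Hom_S(Y, X)` is an open subscheme of a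
closed subscheme of the Hilbert scheme of `Q`, hence of FINITE TYPE over `S` as soon as the Hilbert scheme is.  The tree's ★ piece theorem
`Morphisms.exists_homSchemePiece_of_layers hB1 hB2 hB3` records `m : M_Q → S` as «locally Noetherian, separated, LOCALLY of finite type» only; this file is
the same theorem with the Hilbert-layer letter `hB1` strengthened by `QuasiCompact h` (available: ★-to-be `Motives.exists_hilbertScheme_over_letters_quasiCompact`,
sibling file `Motives/HilbertSchemeOverBaseFiniteType`) and the conclusion strengthened by `QuasiCompact m` — the proof is the ★ proof verbatim
(over the ★ public helpers `piece_fst_comp`, `piece_snd_comp`, `piece_self`, `piece_univ`, `pullbackLeftPullbackSndIso*`) plus one instance line: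
`m = U.ι ≫ c ≫ h` with `U.ι` an open immersion into the locally Noetherian `V(V)` (Mathlib: quasi-compact), `c` a closed immersion and `h` quasi-compact.
WHY: Chevalley's constructibility theorem downstream (cell `hodgecm-mathlib`, P6 SPREAD door organ (SP3-a1) «Hilbert layer ∕ Hom pieces of finite type»,
LEAD F0P6-plan M-17n; consumers: the `Isom`-locus of PEL tuples, `EndomorphismStructureLocus`).

* **`exists_homSchemePiece_of_layers_quasiCompact`** — the piece with `QuasiCompact m`.

HONEST LABEL: HC_CM is proved only modulo the 2 remaining named inputs (hLiu418 24832, h413 24833) until rung 0 closes; count-neutral capital.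

## References

* D. Mumford, J. Fogarty, F. Kirwan, *Geometric Invariant Theory* (3rd ed., Springer, 1994), Ch. 0 §5 (c) (p. 23). [MumfordFogartyKirwan1994]
* U. Görtz, T. Wedhorn, *Algebraic Geometry I* (2nd ed., 2020), Section (4.12), Prop. 10.12. [GortzWedhorn2020]
-/

noncomputable section

set_option backward.isDefEq.respectTransparency false

open CategoryTheory CategoryTheory.Limits CategoryTheory.Abelian AlgebraicGeometry Polynomial
open Literature.AlgebraicGeometry.Modules Literature.AlgebraicGeometry.Modules.SerreTwist
open Literature.Algebra.Homology Literature.Algebra.Homology.LaurentCech Literature.Algebra.Homology.OrderedCech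

namespace Literature.AlgebraicGeometry.Morphisms



section Main

/-- **The piece `M_Q` of the Hom-scheme `Hom_S(Y, X)` cut out by one Hilbert polynomial — QUASI-COMPACT (finite-type) edition**
(★ `exists_homSchemePiece_of_layers` TOKEN FOR TOKEN, with the Hilbert-layer hypothesis strengthened by `QuasiCompact h` — supplied by ★-to-be
`Motives.exists_hilbertScheme_over_letters_quasiCompact` — and the conclusion strengthened by `QuasiCompact m`: the piece is the open
`U` of the closed `V(V)` of `HS_Q`, so `m = U.ι ≫ c ≫ h` is quasi-compact). ([MumfordFogartyKirwan1994] Ch. 0 §5 (c);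
[FGA] no. 221 §4.c): from the HILBERT LAYER (the Hilbert scheme `HS_Q → S` of `𝐏(ι)` with polynomial `Q`, its universal family `Z_H` with
the letters `Q` and its universal property among closed flat families with the letters `Q`), the CLOSED LAYER (an ideal `V` of `HS_Q` killed by
`w : T → HS_Q` iff the pulled-back family lies in `W_T = (Y ×_S X)_T`) and the OPEN LAYER (the locus where a proper flat `Γ → V` maps
isomorphically onto a separated `Y′ → V` is represented by an open `U ⊆ V`), the `S`-scheme `M_Q := U ⊂ V(V) ⊂ HS_Q` (open of closed) with
`u_Q := (Z_M → Y_M)⁻¹ ≫ (Z_M → X_M)` is locally Noetherian, separated and locally of finite type over `S`, the graph family of `u_Q` has the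
letters `Q` (SELF), and every `T`-morphism `φ : Y_T → X_T` (`T` locally Noetherian) whose graph family has the letters `Q` is the base change
of `u_Q` along a UNIQUE `w : T → M_Q` over `S` (UNIV). [cite: MumfordFogartyKirwan1994, Ch. 0 §5 (c) (p. 23)] -/
theorem exists_homSchemePiece_of_layers_quasiCompact
    (hB1 : ∀ ⦃S : Scheme.{0}⦄ [IsLocallyNoetherian S] {ι : Type} (_ : 1 ≤ Nat.card ι) (Q : ℚ[X])
      (_ : ∀ e : ℕ, regularityBound (preHilbertPoly ℚ (Nat.card ι) 0) 0 (preHilbertPoly ℚ (Nat.card ι) 0 - Q) - 1 ≤ (e : ℤ) →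
        ((⌊Q.eval (e : ℚ)⌋₊ : ℕ) : ℚ) = Q.eval (e : ℚ)),
      ∃ (HS : Scheme.{0}) (h : HS ⟶ S) (_ : IsLocallyNoetherian HS) (_ : IsSeparated h) (_ : LocallyOfFiniteType h)
        (_ : QuasiCompact h) (ZH : Scheme.{0}) (iH : ZH ⟶ Morphisms.projectiveSpace ι HS) (_ : IsClosedImmersion iH)
        (_ : Flat (iH ≫ Morphisms.projectiveSpaceFst ι HS)),
        -- SELF: the universal family has the letters `Q`
        (∀ ⦃K : Type⦄ [Field K] ⦃X₀ : Scheme.{0}⦄ (k : X₀ ⟶ ZH) (f₀ : X₀ ⟶ Spec (CommRingCat.of K))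
          (x : Spec (CommRingCat.of K) ⟶ HS), IsPullback k f₀ (iH ≫ Morphisms.projectiveSpaceFst ι HS) x →
          ∀ e : ℕ, regularityBound (preHilbertPoly ℚ (Nat.card ι) 0) 0 (preHilbertPoly ℚ (Nat.card ι) 0 - Q) - 1 ≤ (e : ℤ) →
            Subsingleton (CategoryTheory.Abelian.Ext.{1} (unitModule X₀) ((Scheme.Modules.pullback k).obj
              (twistMod (iH ≫ pullback.snd (terminal.from HS) (terminal.from (Morphisms.projectiveSpaceInt ι))) (unitModule _) e)) 1) ∧
            ((Module.finrank Γ(Spec (CommRingCat.of K), ⊤) (SecMod ((Scheme.Modules.pullback k).obj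
              (twistMod (iH ≫ pullback.snd (terminal.from HS) (terminal.from (Morphisms.projectiveSpaceInt ι))) (unitModule _) e))
              f₀.appTop.hom ⊤) : ℕ) : ℚ) = Q.eval (e : ℚ)) ∧
        -- UNIV over `S`
        ∀ ⦃T : Scheme.{0}⦄ [IsLocallyNoetherian T] (v : T ⟶ S) ⦃Z : Scheme.{0}⦄ (i : Z ⟶ Morphisms.projectiveSpace ι T)
          [IsClosedImmersion i] [Flat (i ≫ Morphisms.projectiveSpaceFst ι T)],
          (∀ ⦃K : Type⦄ [Field K] ⦃X₀ : Scheme.{0}⦄ (k : X₀ ⟶ Z) (f₀ : X₀ ⟶ Spec (CommRingCat.of K))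
            (x : Spec (CommRingCat.of K) ⟶ T), IsPullback k f₀ (i ≫ Morphisms.projectiveSpaceFst ι T) x →
            ∀ e : ℕ, regularityBound (preHilbertPoly ℚ (Nat.card ι) 0) 0 (preHilbertPoly ℚ (Nat.card ι) 0 - Q) - 1 ≤ (e : ℤ) →
              Subsingleton (CategoryTheory.Abelian.Ext.{1} (unitModule X₀) ((Scheme.Modules.pullback k).obj
                (twistMod (i ≫ pullback.snd (terminal.from T) (terminal.from (Morphisms.projectiveSpaceInt ι))) (unitModule _) e)) 1) ∧
              ((Module.finrank Γ(Spec (CommRingCat.of K), ⊤) (SecMod ((Scheme.Modules.pullback k).obj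
                (twistMod (i ≫ pullback.snd (terminal.from T) (terminal.from (Morphisms.projectiveSpaceInt ι))) (unitModule _) e))
                f₀.appTop.hom ⊤) : ℕ) : ℚ) = Q.eval (e : ℚ)) →
          ∃! w : T ⟶ HS, w ≫ h = v ∧ ∃ e : Z ⟶ ZH, IsPullback e i iH (Morphisms.projectiveSpaceMap ι w))
    (hB2 : ∀ ⦃S Y X : Scheme.{0}⦄ [IsLocallyNoetherian S] (q : Y ⟶ S) (p : X ⟶ S) {ι : Type}
      (_ : 1 ≤ Nat.card ι) (jW : pullback q p ⟶ Morphisms.projectiveSpace ι S) [IsClosedImmersion jW] (Q : ℚ[X])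
      (_ : ∀ e : ℕ, regularityBound (preHilbertPoly ℚ (Nat.card ι) 0) 0 (preHilbertPoly ℚ (Nat.card ι) 0 - Q) - 1 ≤ (e : ℤ) →
        ((⌊Q.eval (e : ℚ)⌋₊ : ℕ) : ℚ) = Q.eval (e : ℚ))
      ⦃HS : Scheme.{0}⦄ [IsLocallyNoetherian HS] (h : HS ⟶ S) ⦃ZH : Scheme.{0}⦄ (iH : ZH ⟶ Morphisms.projectiveSpace ι HS)
      [IsClosedImmersion iH] [Flat (iH ≫ Morphisms.projectiveSpaceFst ι HS)],
      -- the universal family has the letters `Q` (so `(p_Z)_*𝒪(e)` is locally free with base change, as the 2A letter wants)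
      (∀ ⦃K : Type⦄ [Field K] ⦃X₀ : Scheme.{0}⦄ (k : X₀ ⟶ ZH) (f₀ : X₀ ⟶ Spec (CommRingCat.of K))
        (x : Spec (CommRingCat.of K) ⟶ HS), IsPullback k f₀ (iH ≫ Morphisms.projectiveSpaceFst ι HS) x →
        ∀ e : ℕ, regularityBound (preHilbertPoly ℚ (Nat.card ι) 0) 0 (preHilbertPoly ℚ (Nat.card ι) 0 - Q) - 1 ≤ (e : ℤ) →
          Subsingleton (CategoryTheory.Abelian.Ext.{1} (unitModule X₀) ((Scheme.Modules.pullback k).obj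
            (twistMod (iH ≫ pullback.snd (terminal.from HS) (terminal.from (Morphisms.projectiveSpaceInt ι))) (unitModule _) e)) 1) ∧
          ((Module.finrank Γ(Spec (CommRingCat.of K), ⊤) (SecMod ((Scheme.Modules.pullback k).obj
            (twistMod (iH ≫ pullback.snd (terminal.from HS) (terminal.from (Morphisms.projectiveSpaceInt ι))) (unitModule _) e))
            f₀.appTop.hom ⊤) : ℕ) : ℚ) = Q.eval (e : ℚ)) →
      ∃ V : HS.IdealSheafData, ∀ ⦃T : Scheme.{0}⦄ [IsLocallyNoetherian T] (w : T ⟶ HS),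
        V ≤ w.ker ↔
          (pullback.snd jW (Morphisms.projectiveSpaceMap ι h)).ker.comap (Morphisms.projectiveSpaceMap ι w) ≤
            iH.ker.comap (Morphisms.projectiveSpaceMap ι w))
    (hB3 : ∀ ⦃V Γ Y' : Scheme.{0}⦄ (f : Γ ⟶ V) (q' : Y' ⟶ V) (g : Γ ⟶ Y') (hg : g ≫ q' = f)
      [IsProper f] [Flat f] [IsSeparated q'] [UniversallyClosed q'] [IsLocallyNoetherian Y'],
      ∃ U : V.Opens, ∀ ⦃T : Scheme.{0}⦄ (b : T ⟶ V),
        IsIso (pullback.map f b q' b g (𝟙 T) (𝟙 V) (by rw [Category.comp_id, hg]) (by rw [Category.comp_id, Category.id_comp])) ↔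
          Set.range b.base ⊆ (U : Set V)) :
    ∀ ⦃S Y X : Scheme.{0}⦄ [IsLocallyNoetherian S] (q : Y ⟶ S) (p : X ⟶ S) [Flat q]
    (_ : IsProjective q) (_ : IsProjective p) {ι : Type} (_ : 1 ≤ Nat.card ι)
    (jW : pullback q p ⟶ Morphisms.projectiveSpace ι S) [IsClosedImmersion jW]
    (_ : jW ≫ Morphisms.projectiveSpaceFst ι S = pullback.fst q p ≫ q) (Q : ℚ[X])
    (_ : ∀ e : ℕ, regularityBound (preHilbertPoly ℚ (Nat.card ι) 0) 0 (preHilbertPoly ℚ (Nat.card ι) 0 - Q) - 1 ≤ (e : ℤ) →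
      ((⌊Q.eval (e : ℚ)⌋₊ : ℕ) : ℚ) = Q.eval (e : ℚ)),
    ∃ (M : Scheme.{0}) (m : M ⟶ S) (_ : IsLocallyNoetherian M) (_ : IsSeparated m) (_ : LocallyOfFiniteType m)
      (_ : QuasiCompact m) (u : pullback q m ⟶ pullback p m) (_ : u ≫ pullback.snd p m = pullback.snd q m),
      -- (self) the graph family of `u` has the letters `Q` at every field point of `M`
      (∀ (hw : pullback.fst q m ≫ q = (u ≫ pullback.fst p m) ≫ p) (iΓ : pullback q m ⟶ Morphisms.projectiveSpace ι M),
        iΓ ≫ Morphisms.projectiveSpaceFst ι M = pullback.snd q m →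
        iΓ ≫ Morphisms.projectiveSpaceMap ι m = pullback.lift (pullback.fst q m) (u ≫ pullback.fst p m) hw ≫ jW →
        ∀ ⦃K : Type⦄ [Field K] ⦃X₀ : Scheme.{0}⦄ (k : X₀ ⟶ pullback q m) (f₀ : X₀ ⟶ Spec (CommRingCat.of K))
          (x : Spec (CommRingCat.of K) ⟶ M), IsPullback k f₀ (iΓ ≫ Morphisms.projectiveSpaceFst ι M) x →
          ∀ e : ℕ, regularityBound (preHilbertPoly ℚ (Nat.card ι) 0) 0 (preHilbertPoly ℚ (Nat.card ι) 0 - Q) - 1 ≤ (e : ℤ) →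
            Subsingleton (CategoryTheory.Abelian.Ext.{1} (unitModule X₀) ((Scheme.Modules.pullback k).obj
              (twistMod (iΓ ≫ pullback.snd (terminal.from M) (terminal.from (Morphisms.projectiveSpaceInt ι))) (unitModule _) e)) 1) ∧
            ((Module.finrank Γ(Spec (CommRingCat.of K), ⊤) (SecMod ((Scheme.Modules.pullback k).obj
              (twistMod (iΓ ≫ pullback.snd (terminal.from M) (terminal.from (Morphisms.projectiveSpaceInt ι))) (unitModule _) e))
              f₀.appTop.hom ⊤) : ℕ) : ℚ) = Q.eval (e : ℚ)) ∧
      -- (univ) universal among `(T, v, φ)` whose graph family has the letters `Q`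
      ∀ ⦃T : Scheme.{0}⦄ [IsLocallyNoetherian T] (v : T ⟶ S) (φ : pullback q v ⟶ pullback p v)
        (hφ : φ ≫ pullback.snd p v = pullback.snd q v),
        (∀ (hw : pullback.fst q v ≫ q = (φ ≫ pullback.fst p v) ≫ p) (iΓ : pullback q v ⟶ Morphisms.projectiveSpace ι T),
          iΓ ≫ Morphisms.projectiveSpaceFst ι T = pullback.snd q v →
          iΓ ≫ Morphisms.projectiveSpaceMap ι v = pullback.lift (pullback.fst q v) (φ ≫ pullback.fst p v) hw ≫ jW →
          ∀ ⦃K : Type⦄ [Field K] ⦃X₀ : Scheme.{0}⦄ (k : X₀ ⟶ pullback q v) (f₀ : X₀ ⟶ Spec (CommRingCat.of K))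
            (x : Spec (CommRingCat.of K) ⟶ T), IsPullback k f₀ (iΓ ≫ Morphisms.projectiveSpaceFst ι T) x →
            ∀ e : ℕ, regularityBound (preHilbertPoly ℚ (Nat.card ι) 0) 0 (preHilbertPoly ℚ (Nat.card ι) 0 - Q) - 1 ≤ (e : ℤ) →
              Subsingleton (CategoryTheory.Abelian.Ext.{1} (unitModule X₀) ((Scheme.Modules.pullback k).obj
                (twistMod (iΓ ≫ pullback.snd (terminal.from T) (terminal.from (Morphisms.projectiveSpaceInt ι))) (unitModule _) e)) 1) ∧
              ((Module.finrank Γ(Spec (CommRingCat.of K), ⊤) (SecMod ((Scheme.Modules.pullback k).obj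
                (twistMod (iΓ ≫ pullback.snd (terminal.from T) (terminal.from (Morphisms.projectiveSpaceInt ι))) (unitModule _) e))
                f₀.appTop.hom ⊤) : ℕ) : ℚ) = Q.eval (e : ℚ)) →
        ∃! w : T ⟶ M, ∃ (hw : w ≫ m = v),
          φ ≫ pullback.map p v p m (𝟙 X) w (𝟙 S) (by simp) (by simpa using hw.symm) =
            pullback.map q v q m (𝟙 Y) w (𝟙 S) (by simp) (by simpa using hw.symm) ≫ u := by
  intro S Y X _ q p _ hq hp ι hn jW _ hjW Q hQ
  haveI : IsProper q := hq.isProper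
  -- (B1) the Hilbert layer
  obtain ⟨HS, h, hHS, hsep, hlft, hqc, ZH, iH, hiH, hflat, hselfH, hunivH⟩ := hB1 (S := S) hn Q hQ
  haveI := hHS; haveI := hsep; haveI := hlft; haveI := hqc; haveI := hiH; haveI := hflat
  -- (B2) the closed layer: `V(VI) ⊂ HS`
  obtain ⟨VI, hVI⟩ := hB2 q p hn jW Q hQ h iH hselfH
  haveI : IsLocallyNoetherian VI.subscheme := LocallyOfFiniteType.isLocallyNoetherian VI.subschemeι
  have hcV : (pullback.snd jW (Morphisms.projectiveSpaceMap ι h)).ker.comap (Morphisms.projectiveSpaceMap ι VI.subschemeι) ≤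
      iH.ker.comap (Morphisms.projectiveSpaceMap ι VI.subschemeι) :=
    (hVI VI.subschemeι).mp (by rw [Scheme.IdealSheafData.ker_subschemeι])
  have hVfac : ∀ ⦃T : Scheme.{0}⦄ [IsLocallyNoetherian T] (w₀ : T ⟶ HS),
      (pullback.snd jW (Morphisms.projectiveSpaceMap ι h)).ker.comap (Morphisms.projectiveSpaceMap ι w₀) ≤
        iH.ker.comap (Morphisms.projectiveSpaceMap ι w₀) → ∃ w₁ : T ⟶ VI.subscheme, w₁ ≫ VI.subschemeι = w₀ :=
    fun T _ w₀ hle => ⟨IsClosedImmersion.lift VI.subschemeι w₀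
      (by rw [Scheme.IdealSheafData.ker_subschemeι]; exact (hVI w₀).mpr hle), IsClosedImmersion.lift_fac _ _ _⟩
  -- the universal family restricted to `V`: `iV : Z_V ↪ 𝐏(ι; V)`, the pull-back of `iH` along `𝐏(c)`, `c : V ↪ HS`
  set c : VI.subscheme ⟶ HS := VI.subschemeι with hc
  obtain ⟨ZV, iV, gH, hiV, HV⟩ : ∃ (ZV : Scheme.{0}) (iV : ZV ⟶ Morphisms.projectiveSpace ι VI.subscheme) (gH : ZV ⟶ ZH),
      IsClosedImmersion iV ∧ IsPullback gH iV iH (Morphisms.projectiveSpaceMap ι c) :=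
    ⟨_, pullback.fst (Morphisms.projectiveSpaceMap ι c) iH, pullback.snd _ _, MorphismProperty.pullback_fst _ _ hiH,
      (IsPullback.of_hasPullback _ _).flip⟩
  haveI := hiV
  haveI : Flat (iV ≫ Morphisms.projectiveSpaceFst ι VI.subscheme) :=
    MorphismProperty.of_isPullback (HV.paste_vert (Morphisms.isPullback_projectiveSpaceMap ι c)) hflat
  -- `Z_V ⊂ W_V`: the morphism `a : Z_V → Y ×_S X` with `a ≫ jW = iV ≫ 𝐏(c ≫ h)`
  obtain ⟨a, ha⟩ : ∃ a : ZV ⟶ pullback q p, a ≫ jW = iV ≫ Morphisms.projectiveSpaceMap ι (c ≫ h) := by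
    haveI : IsClosedImmersion (pullback.snd jW (Morphisms.projectiveSpaceMap ι h)) :=
      MorphismProperty.pullback_snd _ _ inferInstance
    have hker : (pullback.fst (Morphisms.projectiveSpaceMap ι c) (pullback.snd jW (Morphisms.projectiveSpaceMap ι h))).ker ≤
        iV.ker := by
      rw [Scheme.IdealSheafData.ker_fst_of_isClosedImmersion, ← HV.flip.isoPullback_hom_fst, Scheme.Hom.ker_comp_of_isIso,
        Scheme.IdealSheafData.ker_fst_of_isClosedImmersion]
      exact hcV
    refine ⟨IsClosedImmersion.lift _ iV hker ≫ pullback.snd _ _ ≫ pullback.fst jW _, ?_⟩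
    rw [Category.assoc, Category.assoc, pullback.condition,
      ← pullback.condition_assoc (f := Morphisms.projectiveSpaceMap ι c) (g := pullback.snd jW (Morphisms.projectiveSpaceMap ι h)),
      IsClosedImmersion.lift_fac_assoc, projectiveSpaceMap_comp]
  -- the projection `gY : Z_V → Y_V`
  obtain ⟨gY, hgY₁, hgY₂⟩ : ∃ gY : ZV ⟶ pullback q (c ≫ h), gY ≫ pullback.fst q (c ≫ h) = a ≫ pullback.fst q p ∧
      gY ≫ pullback.snd q (c ≫ h) = iV ≫ Morphisms.projectiveSpaceFst ι VI.subscheme :=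
    ⟨pullback.lift _ _ (piece_fst_comp q p jW hjW h c iV a ha), pullback.lift_fst _ _ _, pullback.lift_snd _ _ _⟩
  -- (B3) the open layer: `U ⊆ V` where `Z_V → Y_V` becomes an isomorphism
  obtain ⟨U, hU⟩ := hB3 (iV ≫ Morphisms.projectiveSpaceFst ι VI.subscheme) (pullback.snd q (c ≫ h)) gY hgY₂
  -- over `U` the projection is an isomorphism `gU`; `σ : Y_U ≅ Z_U`
  obtain ⟨gU, hgU, hgU₁, hgU₂⟩ : ∃ gU : pullback (iV ≫ Morphisms.projectiveSpaceFst ι VI.subscheme) U.ι ⟶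
      pullback (pullback.snd q (c ≫ h)) U.ι, IsIso gU ∧ gU ≫ pullback.fst _ _ = pullback.fst _ _ ≫ gY ∧
      gU ≫ pullback.snd _ _ = pullback.snd _ _ :=
    ⟨_, (hU U.ι).mpr (by rw [Scheme.Opens.range_ι]), pullback.lift_fst _ _ _,
      (pullback.lift_snd _ _ _).trans (Category.comp_id _)⟩
  haveI := hgU
  obtain ⟨σ, hσ, hσ₁, hσ₂⟩ : ∃ σ : pullback q (U.ι ≫ c ≫ h) ⟶ pullback (iV ≫ Morphisms.projectiveSpaceFst ι VI.subscheme) U.ι,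
      IsIso σ ∧ σ ≫ pullback.fst _ _ ≫ a ≫ pullback.fst q p = pullback.fst q _ ∧ σ ≫ pullback.snd _ _ = pullback.snd q _ := by
    have hinv₁ : inv gU ≫ pullback.fst _ _ ≫ gY = pullback.fst _ _ := by rw [IsIso.inv_comp_eq, hgU₁]
    have hinv₂ : inv gU ≫ pullback.snd _ _ = pullback.snd _ _ := by rw [IsIso.inv_comp_eq, hgU₂]
    refine ⟨(pullbackLeftPullbackSndIso q (c ≫ h) U.ι).inv ≫ inv gU, inferInstance, ?_, ?_⟩
    · rw [← hgY₁, Category.assoc, reassoc_of% hinv₁, pullbackLeftPullbackSndIso_inv_fst]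
    · rw [Category.assoc, hinv₂, pullbackLeftPullbackSndIso_inv_snd_snd]
  haveI := hσ
  -- the universal morphism `u : Y_M → X_M` over `M := U`
  have hu : (σ ≫ pullback.fst _ _ ≫ a ≫ pullback.snd q p) ≫ p = pullback.snd q (U.ι ≫ c ≫ h) ≫ U.ι ≫ c ≫ h := by
    have hcond : pullback.fst (iV ≫ Morphisms.projectiveSpaceFst ι VI.subscheme) U.ι ≫ iV ≫
        Morphisms.projectiveSpaceFst ι VI.subscheme = pullback.snd _ _ ≫ U.ι := by
      simpa only [Category.assoc] using pullback.condition
    have e := piece_snd_comp q p jW hjW h c iV a ha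
    simp only [Category.assoc] at e ⊢
    rw [e, reassoc_of% hcond, reassoc_of% hσ₂]
  obtain ⟨u, hu₁, hu₂⟩ : ∃ u : pullback q (U.ι ≫ c ≫ h) ⟶ pullback p (U.ι ≫ c ≫ h),
      u ≫ pullback.fst p _ = σ ≫ pullback.fst _ _ ≫ a ≫ pullback.snd q p ∧ u ≫ pullback.snd p _ = pullback.snd q _ :=
    ⟨pullback.lift _ _ hu, pullback.lift_fst _ _ _, pullback.lift_snd _ _ _⟩
  haveI : QuasiCompact (U.ι ≫ c ≫ h) := inferInstance
  refine ⟨U, U.ι ≫ c ≫ h, inferInstance, inferInstance, inferInstance, inferInstance, u, hu₂, ?_, ?_⟩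
  · -- SELF
    intro hw iΓ h₁ h₂ K _ X₀ k f₀ x H e he
    exact piece_self q p jW h iH c iV gH HV a ha U u σ hσ₁ hσ₂ hu₁ _ Q hselfH hw iΓ h₁ h₂ k f₀ x H e he
  · -- UNIV
    intro T _ v φ hφ hlet
    exact piece_univ q p jW hjW h iH c iV gH HV a ha U u σ hσ₁ hσ₂ hu₁ hu₂ _ hunivH hVfac gY hgY₁ hgY₂ hU v φ hφ hlet

end Main

end Literature.AlgebraicGeometry.Morphisms

end
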